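import Summits.AnomalousDissipation.AnomalousDissipation.Theorems.QuarticGate.Negative.LevelOne
import Summits.AnomalousDissipation.AnomalousDissipation.Theorems.MomentParityQuarticGateAtomRows
import Literature.Analysis.FunctionSpaces.TorusHolderSobolevEmbedding

/-!
# Fourier dictionary for the axial Casimir stubs (line `axis-sectors` of crux `MomentParity.QuarticGate`), part 1

Helper file for the stubs `stub_axialQuadRigidity` (S2q) and `stub_noAxialCubicCasimir` (S2c) of
the line `axis-sectors` (crux stmt-AnomalousDissipation-11464). Both stubs are statements about
LEVEL-`N` fields `u ∈ H` (`IsLevel N u`: `û(k) = 0` off the punctured ball `S* = (freqBall N).erase 0`)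
tested against BAND tests `g` (`IsBandTest N g`), and are decided by finite-dimensional linear
algebra in the Fourier coefficients `û = coef u`, `ĝ = tcoef g` (`Negative/LevelOne.lean`). This
file is the dictionary between the two languages:

* `coef`/`tcoef` bookkeeping: `isLevel_iff_coef`, `isConjSymm_coef`, `sum_mul_coef_eq_zero`
  (transversality `k · û(k) = 0`), `isTransversal_coef`, `coef_zero` (mean zero), and the same for
  band tests;
* (D3) `exists_isLevel_coef_eq`: EVERY conjugate-symmetric transversal family `c` supported in `S*`
  is `coef u` for a level-`N` field `u` (represented by `realTrigPoly S* c`), and the transfer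
  principle `forall_isLevel_iff_forall_coef`;
* (D1) `pairing_eq_sum_coef_of_isBandTest`, `pairing_eq_sum_coef_of_isLevel`: `(u, g) = Σ_{k ∈ S*} Re ⟪û k, ĝ k⟫_ℂ`
  (Mathlib convention: `⟪·,·⟫_ℂ` conjugate-linear in the first slot), also over the full ball;
* (D2) `euler_bracket_eq_sum_coef`, `euler_bracket_polyGrad_eq_sum_coef`,
  `euler_bracket_polyGrad_eq_sum_eval_mul`, `tcoef_polyGrad_of_isBandTest`: the Euler bracket
  `⟨B(u), ∇p(u)⟩ = nsGeneratorPairing 0 0 u (polyGrad g P u)` as the explicit finite sum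
  `Σ_{k ∈ S} Re ⟪convectionCoeff S û 𝓕(∇p(u)) k, û k⟫` with `𝓕(∇p(u)) = Σᵢ ∂ᵢP((u,g)) ĝᵢ`, and the
  Casimir clause / the observable in pure coefficient form (`casimir_iff_coef`, `eval_pairing_eq_eval_coef`).

Translates, the momentum split and the Nyquist bookkeeping are in part 2.
-/

namespace Summit.AnomalousDissipation.AnomalousDissipation.Theorems.MomentParityQuarticGate

open MeasureTheory Filter
open scoped InnerProductSpace RealInnerProductSpace ComplexConjugate ENNReal
open Literature.Analysis.FunctionSpaces Literature.Analysis.FluidPDE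
open Summit.AnomalousDissipation.AnomalousDissipation.Theses.MomentParity
open Summit.AnomalousDissipation.AnomalousDissipation.Theorems.QuarticGate.Negative

-- `Summit.<Summit>.<Problem>` is the tree's mandated summit-side namespace (CONVENTIONS §2); for this
-- single-conjunct summit the two coincide, so the duplicate is deliberate.
set_option linter.dupNamespace false

noncomputable section

/-! ## `coef` / `tcoef` bookkeeping -/

section Basics

/-- `IsLevel N u` is the statement `û(k) = 0` off the punctured ball, in terms of `coef`
(definitional unfolding). [folklore] -/
theorem isLevel_iff_coef {N : ℕ} {u : Torus.energySpace (Fin 3)} :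
    IsLevel N u ↔ ∀ k ∉ (Torus.freqBall N).erase (0 : Fin 3 → ℤ), coef u k = 0 :=
  Iff.rfl

/-- A level-`N` field has no coefficients off the punctured ball. [folklore] -/
theorem coef_eq_zero_of_not_mem {N : ℕ} {u : Torus.energySpace (Fin 3)} (hu : IsLevel N u)
    {k : Fin 3 → ℤ} (hk : k ∉ (Torus.freqBall N).erase (0 : Fin 3 → ℤ)) : coef u k = 0 :=
  hu k hk

/-- `IsBandTest N g` unfolded through `tcoef` (definitional unfolding). [folklore] -/
theorem isBandTest_iff_tcoef {N : ℕ} {g : UnitAddTorus (Fin 3) → EuclideanSpace ℝ (Fin 3)} :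
    IsBandTest N g ↔ Torus.IsSmooth g ∧ Torus.IsDivFree g ∧ Torus.HasZeroMean g ∧
      ∀ k ∉ (Torus.freqBall N).erase (0 : Fin 3 → ℤ), tcoef g k = 0 :=
  Iff.rfl

/-- A band test has no coefficients off the punctured ball. [folklore] -/
theorem tcoef_eq_zero_of_not_mem {N : ℕ} {g : UnitAddTorus (Fin 3) → EuclideanSpace ℝ (Fin 3)}
    (hg : IsBandTest N g) {k : Fin 3 → ℤ} (hk : k ∉ (Torus.freqBall N).erase (0 : Fin 3 → ℤ)) :
    tcoef g k = 0 :=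
  hg.2.2.2 k hk

/-- The coefficients of a field `u ∈ H` are conjugate symmetric: `û(-k) = conj û(k)`. [folklore] -/
theorem isConjSymm_coef (u : Torus.energySpace (Fin 3)) : Torus.IsConjSymm (coef u) :=
  Torus.isConjSymm_mFourierCoeff ((Lp.memLp u.1).integrable one_le_two)

/-- The coefficients of an integrable real field are conjugate symmetric. [folklore] -/
theorem isConjSymm_tcoef {g : UnitAddTorus (Fin 3) → EuclideanSpace ℝ (Fin 3)}
    (hg : Integrable g volume) : Torus.IsConjSymm (tcoef g) :=
  Torus.isConjSymm_mFourierCoeff hg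

/-- **Transversality of `H`**: `k · û(k) = Σⱼ kⱼ û(k)ⱼ = 0` for every `u ∈ H` and every `k`
(elements of `H` are weakly divergence free). [folklore] -/
theorem sum_mul_coef_eq_zero (u : Torus.energySpace (Fin 3)) (k : Fin 3 → ℤ) :
    ∑ j, (k j : ℂ) * coef u k j = 0 :=
  (Torus.isWeaklyDivFree_of_mem_energySpace u.2).sum_mul_mFourierCoeff_eq_zero (Lp.memLp _) k

/-- `coef u` is transversal on every frequency set. [folklore] -/
theorem isTransversal_coef (u : Torus.energySpace (Fin 3)) (S : Finset (Fin 3 → ℤ)) :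
    Torus.IsTransversal S (coef u) :=
  fun k _ => sum_mul_coef_eq_zero u k

/-- Transversality of the coefficients of a smooth divergence-free test field. [folklore] -/
theorem sum_mul_tcoef_eq_zero {g : UnitAddTorus (Fin 3) → EuclideanSpace ℝ (Fin 3)}
    (hg : Torus.IsSmooth g) (hdiv : Torus.IsDivFree g) (k : Fin 3 → ℤ) :
    ∑ j, (k j : ℂ) * tcoef g k j = 0 :=
  hdiv.sum_mul_mFourierCoeff_eq_zero hg k

/-- `tcoef g` of a band test is transversal on every frequency set. [folklore] -/
theorem isTransversal_tcoef {N : ℕ} {g : UnitAddTorus (Fin 3) → EuclideanSpace ℝ (Fin 3)}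
    (hg : IsBandTest N g) (S : Finset (Fin 3 → ℤ)) : Torus.IsTransversal S (tcoef g) :=
  fun k _ => sum_mul_tcoef_eq_zero hg.1 hg.2.1 k

/-- **Mean zero**: `û(0) = 0` for every `u ∈ H`. [folklore] -/
theorem coef_zero (u : Torus.energySpace (Fin 3)) : coef u 0 = 0 := by
  change UnitAddTorus.mFourierCoeff _ 0 = 0
  rw [Torus.mFourierCoeff_eq_integral_volume, neg_zero, UnitAddTorus.mFourier_zero]
  simp only [ContinuousMap.one_apply, one_smul, Function.comp_apply]
  have hL := (EuclideanSpace.complexify : EuclideanSpace ℝ (Fin 3) →ₗᵢ[ℝ] EuclideanSpace ℂ (Fin 3))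
    |>.toContinuousLinearMap.integral_comp_comm ((Lp.memLp u.1).integrable one_le_two)
  simp only [LinearIsometry.coe_toContinuousLinearMap] at hL
  rw [hL, Torus.integral_eq_zero_of_mem_energySpace u.2, map_zero]

/-- `ĝ(0) = 0` for a band test. [folklore] -/
theorem tcoef_zero {N : ℕ} {g : UnitAddTorus (Fin 3) → EuclideanSpace ℝ (Fin 3)} (hg : IsBandTest N g) :
    tcoef g 0 = 0 :=
  hg.2.2.2 0 (by simp)

/-- A sum over the full ball of a summand vanishing at the mean mode is the sum over the punctured
ball (bookkeeping between the two conventions `freqBall N` / `(freqBall N).erase 0`). [folklore] -/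
theorem sum_freqBall_erase_zero {N : ℕ} {F : (Fin 3 → ℤ) → ℝ} (h0 : F 0 = 0) :
    ∑ k ∈ (Torus.freqBall N).erase 0, F k = ∑ k ∈ Torus.freqBall N, F k :=
  Finset.sum_erase _ h0

end Basics

/-! ## D3 — level-`N` fields with prescribed coefficients -/

section Prescribed

/-- **D3 — every admissible coefficient family is realised by a level-`N` field.** For a
conjugate-symmetric family `c` that is transversal on and supported in the punctured ball
`S* = (freqBall N).erase 0` there is `u ∈ H` of level `N` with `coef u = c`, represented by the real
trigonometric polynomial `realTrigPoly S* c`. [folklore] -/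
theorem exists_isLevel_coef_eq (N : ℕ) (c : (Fin 3 → ℤ) → EuclideanSpace ℂ (Fin 3))
    (hc : Torus.IsConjSymm c) (hT : Torus.IsTransversal ((Torus.freqBall N).erase 0) c)
    (hsupp : ∀ k ∉ (Torus.freqBall N).erase (0 : Fin 3 → ℤ), c k = 0) :
    ∃ u : Torus.energySpace (Fin 3), IsLevel N u ∧ (∀ k, coef u k = c k) ∧
      (u.1 : UnitAddTorus (Fin 3) → EuclideanSpace ℝ (Fin 3)) =ᵐ[volume]
        Torus.realTrigPoly ((Torus.freqBall N).erase 0) c := by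
  obtain ⟨u, hu⟩ := exists_energySpace_coe_ae_eq_realTrigPoly N c hT
  have hcoef : ∀ k, coef u k = c k := fun k => by
    change UnitAddTorus.mFourierCoeff _ k = _
    rw [mFourierCoeff_coe_of_ae_eq hu hc k]
    split_ifs with hk
    · rfl
    · exact (hsupp k hk).symm
  exact ⟨u, fun k hk => (hcoef k).trans (hsupp k hk), hcoef, hu⟩

/-- **Transfer principle.** A property of coefficient families holds for `coef u` of every
level-`N` field `u` iff it holds for every conjugate-symmetric family transversal on and supported
in the punctured ball. [folklore] -/
theorem forall_isLevel_iff_forall_coef {N : ℕ}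
    (Q : ((Fin 3 → ℤ) → EuclideanSpace ℂ (Fin 3)) → Prop) :
    (∀ u : Torus.energySpace (Fin 3), IsLevel N u → Q (coef u)) ↔
      ∀ c : (Fin 3 → ℤ) → EuclideanSpace ℂ (Fin 3), Torus.IsConjSymm c →
        Torus.IsTransversal ((Torus.freqBall N).erase 0) c →
        (∀ k ∉ (Torus.freqBall N).erase (0 : Fin 3 → ℤ), c k = 0) → Q c := by
  constructor
  · intro h c hc hT hsupp
    obtain ⟨u, hu, hcoef, -⟩ := exists_isLevel_coef_eq N c hc hT hsupp
    have : coef u = c := funext hcoef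
    exact this ▸ h u hu
  · intro h u hu
    exact h (coef u) (isConjSymm_coef u) (isTransversal_coef u _) hu

/-- A level-`N` field is represented by the real trigonometric polynomial of its coefficients:
`u = realTrigPoly S* (coef u)` a.e. (so every `…_of_ae_eq` lemma of `…AtomRows` applies with
`c = coef u`). [folklore] -/
theorem coe_ae_eq_realTrigPoly_coef {N : ℕ} {u : Torus.energySpace (Fin 3)} (hu : IsLevel N u) :
    (u.1 : UnitAddTorus (Fin 3) → EuclideanSpace ℝ (Fin 3)) =ᵐ[volume]
      Torus.realTrigPoly ((Torus.freqBall N).erase 0) (coef u) := by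
  have h := Summit.AnomalousDissipation.AnomalousDissipation.Theorems.CubicParityLoud.Negative.fourierTruncate_ae_eq_of_isLevel
    (u := u) hu
  refine h.symm.trans (ae_of_all _ fun x => ?_)
  change Torus.realTrigPoly (Torus.freqBall N) (coef u) x = _
  rw [Torus.realTrigPoly_eq_comp, Torus.realTrigPoly_eq_comp,
    Torus.trigPoly_subset (c := coef u) (Finset.erase_subset 0 (Torus.freqBall N)) (fun k _ hk => hu k hk)]

end Prescribed

/-! ## D1 — pairings in coefficients -/

section Pairing

/-- **D1 — pairing against a band test**: `(u, g) = Σ_{k ∈ S*} Re ⟪û k, ĝ k⟫_ℂ` for every `u ∈ H`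
(finite Parseval; `ĝ` vanishes off `S*`). [folklore] -/
theorem pairing_eq_sum_coef_of_isBandTest {N : ℕ} (u : Torus.energySpace (Fin 3))
    {g : UnitAddTorus (Fin 3) → EuclideanSpace ℝ (Fin 3)} (hg : IsBandTest N g) :
    Torus.pairing u.1 g = ∑ k ∈ (Torus.freqBall N).erase 0, (inner ℂ (coef u k) (tcoef g k)).re :=
  Torus.integral_inner_eq_sum_of_band_limited (Lp.memLp _) (hg.1.memLp 2) hg.2.2.2

/-- Pairing against an `L²` field band-limited to an arbitrary finite set `S`. [folklore] -/
theorem pairing_eq_sum_coef_of_tcoef_eq_zero (u : Torus.energySpace (Fin 3))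
    {g : UnitAddTorus (Fin 3) → EuclideanSpace ℝ (Fin 3)} (hg : MemLp g 2 volume)
    {S : Finset (Fin 3 → ℤ)} (hband : ∀ k ∉ S, tcoef g k = 0) :
    Torus.pairing u.1 g = ∑ k ∈ S, (inner ℂ (coef u k) (tcoef g k)).re :=
  Torus.integral_inner_eq_sum_of_band_limited (Lp.memLp _) hg hband

/-- **D1 — pairing of a level-`N` field** against any `L²` field: `(u, g) = Σ_{k ∈ S*} Re ⟪û k, ĝ k⟫_ℂ`.
[folklore] -/
theorem pairing_eq_sum_coef_of_isLevel {N : ℕ} {u : Torus.energySpace (Fin 3)} (hu : IsLevel N u)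
    {g : UnitAddTorus (Fin 3) → EuclideanSpace ℝ (Fin 3)} (hg : MemLp g 2 volume) :
    Torus.pairing u.1 g = ∑ k ∈ (Torus.freqBall N).erase 0, (inner ℂ (coef u k) (tcoef g k)).re := by
  unfold Torus.pairing
  rw [integral_congr_ae (ae_of_all _ fun x => real_inner_comm (g x) _ :
      (fun x => ⟪(u.1 : UnitAddTorus (Fin 3) → EuclideanSpace ℝ (Fin 3)) x, g x⟫_ℝ) =ᵐ[volume]
        fun x => ⟪g x, (u.1 : UnitAddTorus (Fin 3) → EuclideanSpace ℝ (Fin 3)) x⟫_ℝ),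
    Torus.integral_inner_eq_sum_of_band_limited hg (Lp.memLp _) hu]
  refine Finset.sum_congr rfl fun k _ => ?_
  rw [← inner_conj_symm, Complex.conj_re]
  rfl

/-- The same sums over the full ball `S = freqBall N` (the `k = 0` term vanishes, `û(0) = 0`). [folklore] -/
theorem pairing_eq_sum_freqBall_coef_of_isBandTest {N : ℕ} (u : Torus.energySpace (Fin 3))
    {g : UnitAddTorus (Fin 3) → EuclideanSpace ℝ (Fin 3)} (hg : IsBandTest N g) :
    Torus.pairing u.1 g = ∑ k ∈ Torus.freqBall N, (inner ℂ (coef u k) (tcoef g k)).re := by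
  rw [pairing_eq_sum_coef_of_isBandTest u hg, sum_freqBall_erase_zero]
  rw [coef_zero, inner_zero_left, Complex.zero_re]

/-- **The observable in coefficients**: `P((u, gⱼ)ⱼ) = P((Σ_{k∈S*} Re ⟪û k, ĝⱼ k⟫)ⱼ)`. [folklore] -/
theorem eval_pairing_eq_eval_coef {N m : ℕ} (u : Torus.energySpace (Fin 3))
    (g : Fin m → UnitAddTorus (Fin 3) → EuclideanSpace ℝ (Fin 3)) (hg : ∀ i, IsBandTest N (g i))
    (P : MvPolynomial (Fin m) ℝ) :
    MvPolynomial.eval (fun j => Torus.pairing u.1 (g j)) P =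
      MvPolynomial.eval (fun j => ∑ k ∈ (Torus.freqBall N).erase 0,
        (inner ℂ (coef u k) (tcoef (g j) k)).re) P := by
  have h : (fun j => Torus.pairing u.1 (g j)) = fun j => ∑ k ∈ (Torus.freqBall N).erase 0,
      (inner ℂ (coef u k) (tcoef (g j) k)).re := funext fun j => pairing_eq_sum_coef_of_isBandTest u (hg j)
  rw [h]

end Pairing

/-! ## D2 — the Euler bracket in coefficients -/

section Bracket

/-- `⟨F(u), w⟩` at `ν = 0`, `f = 0` is the inertial pairing `∫ (u ⊗ u) : ∇w`. [folklore] -/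
theorem nsGeneratorPairing_zero_zero_eq_inertialPairing (u : Torus.energySpace (Fin 3))
    (w : UnitAddTorus (Fin 3) → EuclideanSpace ℝ (Fin 3)) :
    Torus.nsGeneratorPairing (d := Fin 3) 0 0 u w = Torus.inertialPairing u.1 w := by
  unfold Torus.nsGeneratorPairing
  simp

/-- **D2 — the Euler bracket of a level-`N` field against a smooth band-limited test, in
coefficients**: `⟨B(u), w⟩ = Σ_{k ∈ S} Re ⟪convectionCoeff S û ŵ k, û k⟫_ℂ`, `S = freqBall N`
(`inertialPairing_eq_sum_convectionCoeff`). [folklore] -/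
theorem euler_bracket_eq_sum_coef {N : ℕ} {u : Torus.energySpace (Fin 3)} (hu : IsLevel N u)
    {w : UnitAddTorus (Fin 3) → EuclideanSpace ℝ (Fin 3)} (hw : Torus.IsSmooth w)
    (hwb : ∀ k ∉ (Torus.freqBall N).erase (0 : Fin 3 → ℤ), tcoef w k = 0) :
    Torus.nsGeneratorPairing (d := Fin 3) 0 0 u w =
      ∑ k ∈ Torus.freqBall N,
        (inner ℂ (Torus.convectionCoeff (Torus.freqBall N) (coef u) (tcoef w) k) (coef u k)).re := by
  rw [nsGeneratorPairing_zero_zero_eq_inertialPairing, inertialPairing_eq_sum_convectionCoeff u hu hw hwb]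

/-- **D2 for a band test**: `{(u,g), B_N}(u) = ⟨B(u), g⟩ = Σ_{k ∈ S} Re ⟪convectionCoeff S û ĝ k, û k⟫_ℂ`.
[folklore] -/
theorem euler_bracket_eq_sum_coef_of_isBandTest {N : ℕ} {u : Torus.energySpace (Fin 3)}
    (hu : IsLevel N u) {g : UnitAddTorus (Fin 3) → EuclideanSpace ℝ (Fin 3)} (hg : IsBandTest N g) :
    Torus.nsGeneratorPairing (d := Fin 3) 0 0 u g =
      ∑ k ∈ Torus.freqBall N,
        (inner ℂ (Torus.convectionCoeff (Torus.freqBall N) (coef u) (tcoef g) k) (coef u k)).re :=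
  euler_bracket_eq_sum_coef hu hg.1 hg.2.2.2

/-- **Fourier coefficients of `∇p(u)`** for band tests: `𝓕(∇p(u))(k) = Σᵢ ∂ᵢP((u,g)) ĝᵢ(k)`
(`tcoef_polyGrad` of `Negative/LevelOne`). [folklore] -/
theorem tcoef_polyGrad_of_isBandTest {N m : ℕ}
    (g : Fin m → UnitAddTorus (Fin 3) → EuclideanSpace ℝ (Fin 3)) (P : MvPolynomial (Fin m) ℝ)
    (u : Torus.energySpace (Fin 3)) (hg : ∀ i, IsBandTest N (g i)) (k : Fin 3 → ℤ) :
    tcoef (polyGrad g P u) k = ∑ i, ((MvPolynomial.eval (fun j => Torus.pairing u.1 (g j))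
      (MvPolynomial.pderiv i P) : ℝ) : ℂ) • tcoef (g i) k :=
  tcoef_polyGrad g P u (fun i => (hg i).1) k

/-- **D2 — the Euler bracket of a polynomial observable in coefficients**:
`⟨B(u), ∇p(u)⟩ = Σ_{k ∈ S} Re ⟪convectionCoeff S û 𝓕(∇p(u)) k, û k⟫_ℂ`. [folklore] -/
theorem euler_bracket_polyGrad_eq_sum_coef {N m : ℕ} {u : Torus.energySpace (Fin 3)} (hu : IsLevel N u)
    (g : Fin m → UnitAddTorus (Fin 3) → EuclideanSpace ℝ (Fin 3)) (hg : ∀ i, IsBandTest N (g i))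
    (P : MvPolynomial (Fin m) ℝ) :
    Torus.nsGeneratorPairing (d := Fin 3) 0 0 u (polyGrad g P u) =
      ∑ k ∈ Torus.freqBall N, (inner ℂ (Torus.convectionCoeff (Torus.freqBall N) (coef u)
        (tcoef (polyGrad g P u)) k) (coef u k)).re :=
  euler_bracket_eq_sum_coef hu
    (Summit.AnomalousDissipation.AnomalousDissipation.Theorems.QuarticGate.Negative.isSmooth_polyGrad g P u
      fun i => (hg i).1)
    fun _ hk => tcoef_polyGrad_eq_zero g P u hg hk

/-- **The bracket is a derivation**: `⟨B(u), ∇p(u)⟩ = Σᵢ ∂ᵢP((u,g)) ⟨B(u), gᵢ⟩` (linearity of the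
row in the test field; smooth `gᵢ`, any `u ∈ H`). [folklore] -/
theorem euler_bracket_polyGrad_eq_sum_eval_mul {m : ℕ} (u : Torus.energySpace (Fin 3))
    (g : Fin m → UnitAddTorus (Fin 3) → EuclideanSpace ℝ (Fin 3)) (hg : ∀ i, Torus.IsSmooth (g i))
    (P : MvPolynomial (Fin m) ℝ) :
    Torus.nsGeneratorPairing (d := Fin 3) 0 0 u (polyGrad g P u) =
      ∑ i, MvPolynomial.eval (fun j => Torus.pairing u.1 (g j)) (MvPolynomial.pderiv i P) *
        Torus.nsGeneratorPairing (d := Fin 3) 0 0 u (g i) :=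
  Torus.nsGeneratorPairing_sum_smul 0 (integrable_zero _ _ _) u Finset.univ _ fun i _ => hg i

/-- **D2, fully expanded**: for a level-`N` field and band tests,
`⟨B(u), ∇p(u)⟩ = Σᵢ ∂ᵢP((Σ_{k∈S*} Re⟪û k, ĝⱼ k⟫)ⱼ) · Σ_{k∈S} Re ⟪convectionCoeff S û ĝᵢ k, û k⟫` —
a polynomial in `û` alone (real-trilinear for quadratic `P`, quadrilinear for cubic `P`). [folklore] -/
theorem euler_bracket_polyGrad_eq_sum_coef' {N m : ℕ} {u : Torus.energySpace (Fin 3)} (hu : IsLevel N u)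
    (g : Fin m → UnitAddTorus (Fin 3) → EuclideanSpace ℝ (Fin 3)) (hg : ∀ i, IsBandTest N (g i))
    (P : MvPolynomial (Fin m) ℝ) :
    Torus.nsGeneratorPairing (d := Fin 3) 0 0 u (polyGrad g P u) =
      ∑ i, MvPolynomial.eval (fun j => ∑ k ∈ (Torus.freqBall N).erase 0,
          (inner ℂ (coef u k) (tcoef (g j) k)).re) (MvPolynomial.pderiv i P) *
        ∑ k ∈ Torus.freqBall N,
          (inner ℂ (Torus.convectionCoeff (Torus.freqBall N) (coef u) (tcoef (g i)) k) (coef u k)).re := by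
  rw [euler_bracket_polyGrad_eq_sum_eval_mul u g (fun i => (hg i).1) P]
  refine Finset.sum_congr rfl fun i _ => ?_
  rw [eval_pairing_eq_eval_coef u g hg, euler_bracket_eq_sum_coef_of_isBandTest hu (hg i)]

/-- **The Casimir clause in pure coefficient form.** `p = P((·, g))` is a Casimir of level-`N`
Galerkin–Euler (`⟨B(u), ∇p(u)⟩ = 0` for all level-`N` `u`) iff the explicit polynomial identity
`Σᵢ ∂ᵢP((Σ_{k∈S*} Re⟪c k, ĝⱼ k⟫)ⱼ) · Σ_{k∈S} Re ⟪convectionCoeff S c ĝᵢ k, c k⟫ = 0` holds for every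
conjugate-symmetric family `c` transversal on and supported in `S* = (freqBall N).erase 0`. [folklore] -/
theorem casimir_iff_coef {N m : ℕ} (g : Fin m → UnitAddTorus (Fin 3) → EuclideanSpace ℝ (Fin 3))
    (hg : ∀ i, IsBandTest N (g i)) (P : MvPolynomial (Fin m) ℝ) :
    (∀ u : Torus.energySpace (Fin 3), IsLevel N u →
        Torus.nsGeneratorPairing (d := Fin 3) 0 0 u (polyGrad g P u) = 0) ↔
      ∀ c : (Fin 3 → ℤ) → EuclideanSpace ℂ (Fin 3), Torus.IsConjSymm c →
        Torus.IsTransversal ((Torus.freqBall N).erase 0) c →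
        (∀ k ∉ (Torus.freqBall N).erase (0 : Fin 3 → ℤ), c k = 0) →
        ∑ i, MvPolynomial.eval (fun j => ∑ k ∈ (Torus.freqBall N).erase 0,
            (inner ℂ (c k) (tcoef (g j) k)).re) (MvPolynomial.pderiv i P) *
          ∑ k ∈ Torus.freqBall N,
            (inner ℂ (Torus.convectionCoeff (Torus.freqBall N) c (tcoef (g i)) k) (c k)).re = 0 := by
  rw [← forall_isLevel_iff_forall_coef (N := N) (fun c => ∑ i, MvPolynomial.eval
    (fun j => ∑ k ∈ (Torus.freqBall N).erase 0, (inner ℂ (c k) (tcoef (g j) k)).re) (MvPolynomial.pderiv i P) *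
      ∑ k ∈ Torus.freqBall N, (inner ℂ (Torus.convectionCoeff (Torus.freqBall N) c (tcoef (g i)) k) (c k)).re = 0)]
  refine forall_congr' fun u => forall_congr' fun hu => ?_
  rw [euler_bracket_polyGrad_eq_sum_coef' hu g hg P]

/-- **The observable clause in pure coefficient form**: `P((u, g)) = 0` for all level-`N` `u` iff
`P((Σ_{k∈S*} Re⟪c k, ĝⱼ k⟫)ⱼ) = 0` for every admissible family `c`. [folklore] -/
theorem eval_eq_zero_iff_coef {N m : ℕ} (g : Fin m → UnitAddTorus (Fin 3) → EuclideanSpace ℝ (Fin 3))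
    (hg : ∀ i, IsBandTest N (g i)) (P : MvPolynomial (Fin m) ℝ) :
    (∀ u : Torus.energySpace (Fin 3), IsLevel N u →
        MvPolynomial.eval (fun j => Torus.pairing u.1 (g j)) P = 0) ↔
      ∀ c : (Fin 3 → ℤ) → EuclideanSpace ℂ (Fin 3), Torus.IsConjSymm c →
        Torus.IsTransversal ((Torus.freqBall N).erase 0) c →
        (∀ k ∉ (Torus.freqBall N).erase (0 : Fin 3 → ℤ), c k = 0) →
        MvPolynomial.eval (fun j => ∑ k ∈ (Torus.freqBall N).erase 0,
            (inner ℂ (c k) (tcoef (g j) k)).re) P = 0 := by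
  rw [← forall_isLevel_iff_forall_coef (N := N) (fun c => MvPolynomial.eval
    (fun j => ∑ k ∈ (Torus.freqBall N).erase 0, (inner ℂ (c k) (tcoef (g j) k)).re) P = 0)]
  refine forall_congr' fun u => forall_congr' fun _ => ?_
  rw [eval_pairing_eq_eval_coef u g hg]

end Bracket

end

/-! ## Registered sub-goal (summary) -/

/-- **Registered sub-goal `fourierDictionary_casimir_iff_coef` (summary of this file)**: the Casimir
clause `⟨B(u), ∇p(u)⟩ = 0 on V_N` of level-`N` Galerkin–Euler for the observable `p = P((·, g))` with
band tests `g` is EQUIVALENT to the explicit polynomial identity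
`Σᵢ ∂ᵢP((Σ_{k∈S*} Re⟪c k, ĝⱼ k⟫)ⱼ) · Σ_{k∈S} Re ⟪convectionCoeff S c ĝᵢ k, c k⟫ = 0` for every conjugate-symmetric
family `c` transversal on and supported in `S* = (freqBall N).erase 0` (`S = freqBall N`, `ĝ = 𝓕(complexify ∘ g)`). [folklore] -/
theorem fourierDictionary_casimir_iff_coef : ∀ (N m : ℕ) (g : Fin m → UnitAddTorus (Fin 3) → EuclideanSpace ℝ (Fin 3)) (P : MvPolynomial (Fin m) ℝ), (∀ i, IsBandTest N (g i)) → ((∀ u : Torus.energySpace (Fin 3), IsLevel N u → Torus.nsGeneratorPairing (d := Fin 3) 0 0 u (polyGrad g P u) = 0) ↔ ∀ c : (Fin 3 → ℤ) → EuclideanSpace ℂ (Fin 3), Torus.IsConjSymm c → Torus.IsTransversal ((Torus.freqBall N).erase 0) c → (∀ k ∉ (Torus.freqBall N).erase (0 : Fin 3 → ℤ), c k = 0) → ∑ i, MvPolynomial.eval (fun j => ∑ k ∈ (Torus.freqBall N).erase 0, (inner ℂ (c k) (UnitAddTorus.mFourierCoeff (EuclideanSpace.complexify ∘ g j) k)).re)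 (MvPolynomial.pderiv i P) * ∑ k ∈ Torus.freqBall N, (inner ℂ (Torus.convectionCoeff (Torus.freqBall N) c (fun k => UnitAddTorus.mFourierCoeff (EuclideanSpace.complexify ∘ g i) k) k) (c k)).re = 0) :=
  fun _ _ g P hg => casimir_iff_coef g hg P

end Summit.AnomalousDissipation.AnomalousDissipation.Theorems.MomentParityQuarticGate
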